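import Summits.CriticalPhenomena.SAWScalingLimit.Theorems.SAWDefectDecoherenceMassRatioRenewalDefs
import Literature.Probability.RandomPlanarGeometry.HexMidEdgeSAWDoors

/-!
# Door shift along a flat bottom row (crux `MassRatio`, stmt-CriticalPhenomena-8550, line `flat-root-arc-swap`)

Registered sub-goal `DoorShift.doorShift_le` (lead c2): the one-period target-shift inequality for the
critical spin-`0` two-point mass between two ADJACENT door edges `door m p`, `door m p'`
(`p' = p ± 2`) of a flat bottom row (`bv (m-1) p, bv (m-1) p' ∉ Λ`; `u = bv m q` is the U-vertex
between the door vertices `v = bv m p`, `v' = bv m p'`). A walk `e → door m p` (a vertex list ending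
at `v`) either visits `v'` (cut there: a walk `e → door m p'` and a walk `door m p' → door m p`, total
length `+1`), or visits `u` but not `v'` (then `u` is the vertex before `v`; replace `v` by `v'`: same
length), or neither (append `u, v'`: length `+2`); the three maps are injective on vertex lists, whence
`Z(e → door p) ≤ (x_c⁻² + 1 + x_c⁻¹ Z(door p' → door p)) · Z(e → door p')`.
-/

noncomputable section

namespace Summit.CriticalPhenomena.SAWScalingLimit.Theorems.MassRatio.FlatRoot

open Literature.Probability.LatticeModels Literature.Probability.RandomPlanarGeometry
open Literature.Probability.RandomPlanarGeometry.SAW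
open Summit.CriticalPhenomena.SAWScalingLimit.Theorems.MassRatio.Negative
open Summit.CriticalPhenomena.SAWScalingLimit.Theorems.MassRatio.Renewal (Z door)

namespace DoorShift

/-- The list of (unordered) consecutive pairs of a vertex list. -/
local notation3 "edgesOf " l:arg => List.zipWith (fun u w => s(u, w)) l (List.tail l)

/-- The finite set of vertex lists of the self-avoiding walks `a → z` of `Λ`. -/
local notation3 "VL " Λ:arg a:arg z:arg =>
  Finset.image HexMidEdgeSAW.verts (Finset.univ : Finset (HexMidEdgeSAW Λ a z))

/-! ### Generic helpers -/

/-- Appending a fresh entry keeps a list duplicate-free. [folklore] -/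
theorem nodup_concat {α : Type*} {L : List α} {z : α} (hL : L.Nodup) (hz : z ∉ L) :
    (L ++ [z]).Nodup :=
  List.nodup_append.2 ⟨hL, List.nodup_singleton z, fun b hb c hc hbc => hz (by
    rw [List.mem_singleton] at hc
    rw [← hc, ← hbc]; exact hb)⟩

/-- Appending one related entry to a chain gives a chain. [folklore] -/
theorem isChain_concat {α : Type*} {R : α → α → Prop} {l : List α} {a b : α}
    (h : List.IsChain R l) (hl : l.getLast? = some a) (hab : R a b) : List.IsChain R (l ++ [b]) :=
  List.isChain_append.2 ⟨h, List.isChain_singleton b, fun x hx y hy => by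
    rw [Option.mem_def, hl, Option.some.injEq] at hx
    rw [Option.mem_def, List.head?_cons, Option.some.injEq] at hy
    subst hx; subst hy; exact hab⟩

/-- Equality of two mid-edges written in brick coordinates. [folklore] -/
theorem bv_pair_eq {r₁ p₁ r₂ p₂ r₃ p₃ r₄ p₄ : ℤ}
    (h : s(bv r₁ p₁, bv r₂ p₂) = s(bv r₃ p₃, bv r₄ p₄)) :
    (r₁ = r₃ ∧ p₁ = p₃ ∧ r₂ = r₄ ∧ p₂ = p₄) ∨ (r₁ = r₄ ∧ p₁ = p₄ ∧ r₂ = r₃ ∧ p₂ = p₃) := by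
  rcases Sym2.eq_iff.1 h with ⟨h1, h2⟩ | ⟨h1, h2⟩
  · exact Or.inl ⟨(bv_inj h1).1, (bv_inj h1).2, (bv_inj h2).1, (bv_inj h2).2⟩
  · exact Or.inr ⟨(bv_inj h1).1, (bv_inj h1).2, (bv_inj h2).1, (bv_inj h2).2⟩

/-- The neighbours of the U-vertex `u = bv m q` between the door vertices `v = bv m p` and
`v' = bv m p'`: `v`, `v'` and the vertex `bv (m+1) q` above `u`. [folklore] -/
theorem adj_u_cases {m p p' q : ℤ} (hpm : (p - m) % 2 = 0)
    (hpq : (p' = p + 2 ∧ q = p + 1) ∨ (p' = p - 2 ∧ q = p - 1)) {w : HexVertex}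
    (h : hexGraph.Adj (bv m q) w) : w = bv m p ∨ w = bv m p' ∨ w = bv (m + 1) q := by
  rw [← bv_row_pos w, adj_bv_iff] at h
  rw [← bv_row_pos w]
  rcases h with ⟨h1, h2⟩ | ⟨-, -, h3⟩ | ⟨h1, h2, -⟩
  · have key : pos w = p ∨ pos w = p' := by omega
    rcases key with h3 | h3
    · exact Or.inl (by rw [← h1, h3])
    · exact Or.inr (Or.inl (by rw [← h1, h3]))
  · exfalso; omega
  · exact Or.inr (Or.inr (by rw [h2, ← h1]))

/-- A door whose upper vertex lies in `Λ` is a mid-edge of the domain. [folklore] -/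
theorem door_mem_midEdges {Λ : Finset HexVertex} {m p : ℤ} (h : (p - m) % 2 = 0)
    (hv : bv m p ∈ Λ) : door m p ∈ hexDomainMidEdges Λ :=
  ⟨(SimpleGraph.mem_edgeSet _).2 ((adj_bv_iff _ _ _ _).2 (Or.inr (Or.inr ⟨rfl, by ring, by omega⟩))),
    bv m p, Sym2.mem_mk_right _ _, hv⟩

/-! ### Vertex lists of walks -/

/-- Membership in `VL`. [folklore] -/
theorem mem_VL {Λ : Finset HexVertex} {a z : Sym2 HexVertex} {l : List HexVertex} :
    l ∈ VL Λ a z ↔ ∃ γ : HexMidEdgeSAW Λ a z, γ.verts = l := by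
  simp

/-- The spin-`0` critical mass as a sum over vertex lists (a walk IS its vertex list). [folklore] -/
theorem Z_eq_sum (Λ : Finset HexVertex) (a z : Sym2 HexVertex) :
    Z Λ a z = ∑ l ∈ VL Λ a z, hexCriticalFugacity ^ l.length := by
  unfold Z
  rw [norm_Z_eq_sum _ _ _ hexCriticalFugacity_pos_lt_one.1.le,
    Finset.sum_image fun γ _ γ' _ h => HexMidEdgeSAW.ext h]
  rfl

/-- **Builder.** A nonempty duplicate-free chain `N` of `Λ` starting on the mid-edge `a ∈ Ω`, ending
at `c`, whose used edges `a, {N₀,N₁}, …` are pairwise distinct, is the vertex list of a walk from `a`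
to the door `{d₀, c}` (`d₀ ∉ Λ`, `{d₀, c} ≠ a`). [folklore] -/
theorem mem_VL_of {Λ : Finset HexVertex} {a : Sym2 HexVertex} {d₀ c : HexVertex}
    {N : List HexVertex} (ha : a ∈ hexDomainMidEdges Λ) (hd₀ : d₀ ∉ Λ) (haz : a ≠ s(d₀, c))
    (hN : N ≠ []) (hsub : ∀ w ∈ N, w ∈ Λ) (hnd : N.Nodup) (hch : N.IsChain hexGraph.Adj)
    (hhead : ∀ w, N.head? = some w → w ∈ a) (hlast : N.getLast? = some c)
    (hE : (a :: edgesOf N).Nodup) : N ∈ VL Λ a s(d₀, c) := by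
  refine mem_VL.2 ⟨⟨N, hsub, hnd, hch, hhead, ?_, fun h => (hN h).elim, fun _ => ?_, ha⟩, rfl⟩
  · intro w hw
    rw [hlast, Option.some.injEq] at hw
    rw [← hw]
    exact Sym2.mem_mk_right _ _
  · refine nodup_concat hE fun h => ?_
    rcases List.mem_cons.1 h with h | h
    · exact haz h.symm
    · exact hd₀ (hsub d₀ (forall_mem_of_mem_edges N _ h d₀ (Sym2.mem_mk_left _ _)))

/-! ### The walks `e → door m p` and the three classes -/

section Setting

variable {Λ : Finset HexVertex} {m p p' q : ℤ} {e a z : Sym2 HexVertex}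

/-- The used edges `a, {v₁,v₂}, …, {vₙ₋₁,vₙ}` of a nontrivial walk are pairwise distinct. [folklore] -/
theorem nodup_root_edges (γ : HexMidEdgeSAW Λ a z) (hne : γ.verts ≠ []) :
    (a :: edgesOf γ.verts).Nodup :=
  (List.nodup_append.1 (γ.edges_nodup hne)).1

/-- **Class 3.** If neither `u = bv m q` nor `v' = bv m p'` is visited, appending `u, v'` to a walk
`e → door m p` gives a walk `e → door m p'`. [folklore] -/
theorem class3_mem (γ : HexMidEdgeSAW Λ e (door m p))
    (hpq : (p' = p + 2 ∧ q = p + 1) ∨ (p' = p - 2 ∧ q = p - 1))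
    (hu : bv m q ∈ Λ) (hv' : bv m p' ∈ Λ) (hd : bv (m - 1) p ∉ Λ) (hd' : bv (m - 1) p' ∉ Λ)
    (he1 : e ≠ door m p) (he2 : e ≠ door m p') (he3 : e ≠ s(bv m p, bv m q))
    (he4 : e ≠ s(bv m q, bv m p')) (hul : bv m q ∉ γ.verts) (hv'l : bv m p' ∉ γ.verts) :
    γ.verts ++ [bv m q] ++ [bv m p'] ∈ VL Λ e (door m p') := by
  have hne : γ.verts ≠ [] := fun h => he1 (γ.eq_of_nil h)
  have hlast : γ.verts.getLast? = some (bv m p) := γ.getLast?_eq_of_door rfl hd hne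
  have hne1 : γ.verts ++ [bv m q] ≠ [] := by simp
  have hlast1 : (γ.verts ++ [bv m q]).getLast? = some (bv m q) := by simp
  refine mem_VL_of γ.fst_mem hd' he2 (by simp) (fun w hw => ?_) ?_ ?_ (fun w hw => ?_) (by simp) ?_
  · simp only [List.mem_append, List.mem_singleton] at hw
    rcases hw with (hw | rfl) | rfl
    exacts [γ.subset w hw, hu, hv']
  · refine nodup_concat (nodup_concat γ.nodup hul) fun h => ?_
    rw [List.mem_append, List.mem_singleton] at h
    rcases h with h | h
    · exact hv'l h
    · have := bv_inj h; omega
  · refine isChain_concat (isChain_concat γ.isChain hlast ?_) hlast1 ?_ <;> rw [adj_bv_iff] <;>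
      exact Or.inl ⟨rfl, by omega⟩
  · rw [List.head?_append_of_ne_nil _ hne1, List.head?_append_of_ne_nil _ hne] at hw
    exact γ.head_mem w hw
  · rw [edges_concat hlast1, edges_concat hlast, ← List.cons_append, ← List.cons_append]
    refine nodup_concat (nodup_concat (nodup_root_edges γ hne) fun h => ?_) fun h => ?_
    · rcases List.mem_cons.1 h with h | h
      · exact he3 h.symm
      · exact hul (forall_mem_of_mem_edges _ _ h _ (Sym2.mem_mk_right _ _))
    · rw [List.mem_append, List.mem_cons, List.mem_singleton] at h
      rcases h with (h | h) | h
      · exact he4 h.symm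
      · exact hul (forall_mem_of_mem_edges _ _ h _ (Sym2.mem_mk_left _ _))
      · rcases bv_pair_eq h with ⟨-, h, -⟩ | ⟨-, -, -, h⟩ <;> omega

/-- **Class 2.** If `u = bv m q` is visited but `v' = bv m p'` is not, then `u` is the vertex before
the last one `v = bv m p` (otherwise `u` is followed by the vertex above it, has no room for a
predecessor, so is the first vertex — and the root `e ∌ v, v'` would be the edge `{u, above}`, used
twice), and replacing `v` by `v'` gives a walk `e → door m p'`. [folklore] -/
theorem class2_mem (γ : HexMidEdgeSAW Λ e (door m p)) (hpm : (p - m) % 2 = 0)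
    (hpq : (p' = p + 2 ∧ q = p + 1) ∨ (p' = p - 2 ∧ q = p - 1)) (hv' : bv m p' ∈ Λ)
    (hd : bv (m - 1) p ∉ Λ) (hd' : bv (m - 1) p' ∉ Λ) (he1 : e ≠ door m p) (he2 : e ≠ door m p')
    (he3 : e ≠ s(bv m p, bv m q)) (he4 : e ≠ s(bv m q, bv m p'))
    (hul : bv m q ∈ γ.verts) (hv'l : bv m p' ∉ γ.verts) :
    γ.verts.dropLast ++ [bv m p'] ∈ VL Λ e (door m p') := by
  have hne : γ.verts ≠ [] := fun h => he1 (γ.eq_of_nil h)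
  have hlen : 0 < γ.verts.length := List.length_pos_iff.2 hne
  have hlastv : γ.verts[γ.verts.length - 1]'(by omega) = bv m p := by
    rw [← List.getLast_eq_getElem hne]
    exact γ.getLast_eq_of_door rfl hd hne
  -- Step 1: the shape `γ.verts = A ++ [u] ++ [v]`.
  obtain ⟨A, hA⟩ : ∃ A : List HexVertex, γ.verts = A ++ [bv m q] ++ [bv m p] := by
    obtain ⟨i, hi, hiu⟩ := List.mem_iff_getElem.1 hul
    have hi1 : i + 1 < γ.verts.length := by
      by_contra hcon
      obtain rfl : i = γ.verts.length - 1 := by omega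
      have := bv_inj (hiu.symm.trans hlastv)
      omega
    have hadj : hexGraph.Adj (bv m q) (γ.verts[i + 1]) := by
      have := List.isChain_iff_getElem.1 γ.isChain i hi1
      rwa [hiu] at this
    rcases adj_u_cases hpm hpq hadj with h | h | h
    · -- the successor of `u` is `v`, the last vertex
      have hieq : i + 1 = γ.verts.length - 1 := (γ.nodup.getElem_inj_iff).1 (h.trans hlastv.symm)
      refine ⟨γ.verts.take i, ?_⟩
      conv_lhs => rw [← List.take_append_drop i γ.verts]
      rw [List.append_assoc, List.drop_eq_getElem_cons hi, List.drop_eq_getElem_cons hi1, hiu, h,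
        List.drop_eq_nil_of_le (by omega)]
      rfl
    · exact absurd (h ▸ List.getElem_mem hi1) hv'l
    -- the successor of `u` is the vertex above it: impossible
    exfalso
    cases i with
    | zero =>
      -- `u` is the first vertex, so the root `e` contains `u`
      obtain ⟨w, hw⟩ := Sym2.mem_iff_exists.1 (γ.head_mem (bv m q) (by
        rw [List.head?_eq_getElem?, List.getElem?_eq_getElem hi, hiu]))
      obtain ⟨hedge, -⟩ := γ.fst_mem
      rw [hw] at hedge
      rcases adj_u_cases hpm hpq ((SimpleGraph.mem_edgeSet _).1 hedge) with rfl | rfl | rfl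
      · exact he3 (hw.trans Sym2.eq_swap)
      · exact he4 hw
      · refine (List.nodup_cons.1 (nodup_root_edges γ hne)).1 (mem_edges_iff.2 ⟨0, hi1, ?_⟩)
        rw [hiu, h]
        exact hw
    | succ j =>
      have hadj0 : hexGraph.Adj (γ.verts[j]'(by omega)) (bv m q) := by
        have := List.isChain_iff_getElem.1 γ.isChain j hi
        rwa [hiu] at this
      rcases adj_u_cases hpm hpq hadj0.symm with h' | h' | h'
      · have := (γ.nodup.getElem_inj_iff).1 (h'.trans hlastv.symm)
        omega
      · exact hv'l (h' ▸ List.getElem_mem _)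
      · have := (γ.nodup.getElem_inj_iff).1 (h'.trans h.symm)
        omega
  -- Step 2: the walk `A ++ [u] ++ [v']`.
  rw [hA, List.dropLast_concat]
  have hPne : A ++ [bv m q] ≠ [] := by simp
  have hP : (A ++ [bv m q]).getLast? = some (bv m q) := by simp
  have hsubl : (A ++ [bv m q]).Sublist γ.verts := by
    rw [hA]; exact List.sublist_append_left _ _
  have hv'P : bv m p' ∉ A ++ [bv m q] := fun h => hv'l (hsubl.subset h)
  refine mem_VL_of γ.fst_mem hd' he2 (by simp) (fun w hw => ?_)
    (nodup_concat (γ.nodup.sublist hsubl) hv'P) ?_ (fun w hw => ?_) (by simp) ?_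
  · rw [List.mem_append, List.mem_singleton] at hw
    rcases hw with hw | rfl
    exacts [γ.subset w (hsubl.subset hw), hv']
  · refine isChain_concat ?_ hP ((adj_bv_iff _ _ _ _).2 (Or.inl ⟨rfl, by omega⟩))
    have := γ.isChain
    rw [hA] at this
    exact (List.isChain_append.1 this).1
  · refine γ.head_mem w ?_
    rw [hA, List.head?_append_of_ne_nil _ hPne]
    rwa [List.head?_append_of_ne_nil _ hPne] at hw
  · have h0 := nodup_root_edges γ hne
    rw [hA, edges_concat hP, ← List.cons_append] at h0
    rw [edges_concat hP, ← List.cons_append]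
    refine nodup_concat (List.nodup_append.1 h0).1 fun h => ?_
    rcases List.mem_cons.1 h with h | h
    · exact he4 h.symm
    · exact hv'P (forall_mem_of_mem_edges _ _ h _ (Sym2.mem_mk_right _ _))

/-- **Class 1.** Cutting a walk `e → door m p` at its visit of `v' = bv m p'` (entry `i`): the prefix
up to `v'` is a walk `e → door m p'`, the suffix from `v'` on a walk `door m p' → door m p`.
[folklore] -/
theorem class1_mem (γ : HexMidEdgeSAW Λ e (door m p)) (hpm : (p - m) % 2 = 0)
    (hpq : (p' = p + 2 ∧ q = p + 1) ∨ (p' = p - 2 ∧ q = p - 1)) (hv' : bv m p' ∈ Λ)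
    (hd : bv (m - 1) p ∉ Λ) (hd' : bv (m - 1) p' ∉ Λ) (he2 : e ≠ door m p')
    {i : ℕ} (hi : i < γ.verts.length) (hiv : γ.verts[i] = bv m p') :
    (γ.verts.take (i + 1), γ.verts.drop i) ∈ VL Λ e (door m p') ×ˢ VL Λ (door m p') (door m p) := by
  have hne : γ.verts ≠ [] := List.ne_nil_of_length_pos (by omega)
  have htake : γ.verts.take (i + 1) = γ.verts.take i ++ [bv m p'] := by
    rw [List.take_succ_eq_append_getElem hi, hiv]
  have hdrop : γ.verts.drop i = bv m p' :: γ.verts.drop (i + 1) := by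
    rw [List.drop_eq_getElem_cons hi, hiv]
  have hsplit : γ.verts = γ.verts.take i ++ bv m p' :: γ.verts.drop (i + 1) := by
    rw [← hdrop, List.take_append_drop]
  have hst : (γ.verts.take (i + 1)).Sublist γ.verts := List.take_sublist _ _
  have hsd : (γ.verts.drop i).Sublist γ.verts := List.drop_sublist _ _
  refine Finset.mem_product.2 ⟨mem_VL_of (N := γ.verts.take (i + 1)) γ.fst_mem hd' he2
    (by rw [htake]; simp) (fun w hw => γ.subset w (hst.subset hw)) (γ.nodup.sublist hst)
    (γ.isChain.take _) (fun w hw => ?_) (by rw [htake]; simp) ?_,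
    mem_VL_of (N := γ.verts.drop i) (door_mem_midEdges (by omega) hv') hd (fun h => ?_)
    (by rw [hdrop]; exact List.cons_ne_nil _ _) (fun w hw => γ.subset w (hsd.subset hw))
    (γ.nodup.sublist hsd) (γ.isChain.drop _) (fun w hw => ?_) ?_ ?_⟩
  · rw [List.head?_take, if_neg (by omega)] at hw
    exact γ.head_mem w hw
  · have h0 := nodup_root_edges γ hne
    rw [hsplit, edges_append_cons, ← htake, ← List.cons_append] at h0
    exact (List.nodup_append.1 h0).1
  · rcases bv_pair_eq h with ⟨-, h, -⟩ | ⟨h, -⟩ <;> omega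
  · rw [hdrop, List.head?_cons, Option.some.injEq] at hw
    rw [← hw]
    exact Sym2.mem_mk_right _ _
  · rw [List.getLast?_drop, if_neg (by omega)]
    exact γ.getLast?_eq_of_door rfl hd hne
  · refine List.nodup_cons.2 ⟨fun h => hd' (γ.subset _ (hsd.subset ?_)), edges_nodup (γ.nodup.sublist hsd)⟩
    exact forall_mem_of_mem_edges _ _ h _ (Sym2.mem_mk_left (bv (m - 1) p') (bv m p'))

end Setting

/-! ### The door-shift inequality -/

/-- **Door shift (registered sub-goal).** For two adjacent door edges `door m p`, `door m p'`
(`p' = p ± 2`) of a row `m` whose door vertices `bv m p`, `bv m p'` and the U-vertex `bv m q` between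
them lie in `Λ` while the vertices below the doors do not, and any root `e` off the four local edges:
`Z_Λ(e → door p) ≤ (x_c⁻² + 1 + x_c⁻¹·Z_Λ(door p' → door p))·Z_Λ(e → door p')`. -/
theorem doorShift_le : ∀ (Λ : Finset HexVertex) (m p p' q : ℤ) (e : Sym2 HexVertex), (p - m) % 2 = 0 → ((p' = p + 2 ∧ q = p + 1) ∨ (p' = p - 2 ∧ q = p - 1)) → bv m p ∈ Λ → bv m q ∈ Λ → bv m p' ∈ Λ → bv (m - 1) p ∉ Λ → bv (m - 1) p' ∉ Λ → e ≠ door m p → e ≠ door m p' → e ≠ s(bv m p, bv m q) → e ≠ s(bv m q, bv m p') → Z Λ e (door m p) ≤ (hexCriticalFugacity⁻¹ ^ 2 + 1 + hexCriticalFugacity⁻¹ * Z Λ (door m p') (door m p)) * Z Λ e (door m p') := by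
  intro Λ m p p' q e hpm hpq _ hu hv' hd hd' he1 he2 he3 he4
  obtain ⟨hx0, -⟩ := hexCriticalFugacity_pos_lt_one
  have hx1 : ∀ n : ℕ, hexCriticalFugacity ^ n =
      hexCriticalFugacity⁻¹ * hexCriticalFugacity ^ (n + 1) := fun n => by
    rw [pow_succ, mul_comm, mul_assoc, mul_inv_cancel₀ hx0.ne', mul_one]
  -- every walk `e → door m p` is nontrivial and ends at `v = bv m p`
  have hlv : ∀ l ∈ VL Λ e (door m p), l ≠ [] ∧ l.dropLast ++ [bv m p] = l := fun l hl => by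
    obtain ⟨γ, rfl⟩ := mem_VL.1 hl
    have hne : γ.verts ≠ [] := fun h => he1 (γ.eq_of_nil h)
    refine ⟨hne, ?_⟩
    conv_rhs => rw [← List.dropLast_append_getLast hne, γ.getLast_eq_of_door rfl hd hne]
  -- class 1: cut at `v'`
  have b1 : ∑ l ∈ (VL Λ e (door m p)).filter (fun l => bv m p' ∈ l), hexCriticalFugacity ^ l.length
      ≤ hexCriticalFugacity⁻¹ * (Z Λ e (door m p') * Z Λ (door m p') (door m p)) := by
    rw [Z_eq_sum, Z_eq_sum, Finset.sum_mul_sum, ← Finset.sum_product', Finset.mul_sum]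
    refine (Finset.sum_congr rfl fun l hl => ?_).trans_le (HV.sum_le_sum_of_injOn_of_nonneg
      (fun l : List HexVertex =>
        (l.take (List.idxOf (bv m p') l + 1), l.drop (List.idxOf (bv m p') l)))
      (fun l₁ _ l₂ _ h => ?_) (fun l hl => ?_)
      (fun c : List HexVertex × List HexVertex => hexCriticalFugacity⁻¹ *
        (hexCriticalFugacity ^ c.1.length * hexCriticalFugacity ^ c.2.length))
      fun _ _ => mul_nonneg (inv_nonneg.2 hx0.le)
        (mul_nonneg (pow_nonneg hx0.le _) (pow_nonneg hx0.le _)))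
    · have hi : List.idxOf (bv m p') l + 1 ≤ l.length :=
        List.idxOf_lt_length_iff.2 (Finset.mem_filter.1 hl).2
      show _ = hexCriticalFugacity⁻¹ * (hexCriticalFugacity ^ (l.take (List.idxOf (bv m p') l + 1)).length
        * hexCriticalFugacity ^ (l.drop (List.idxOf (bv m p') l)).length)
      rw [List.length_take, List.length_drop, Nat.min_eq_left hi, ← pow_add,
        show List.idxOf (bv m p') l + 1 + (l.length - List.idxOf (bv m p') l) = l.length + 1 by omega]
      exact hx1 _
    · simp only [Prod.mk.injEq] at h
      rw [← List.take_append_drop (List.idxOf (bv m p') l₁ + 1) l₁, ← List.tail_drop, h.1, h.2,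
        List.tail_drop, List.take_append_drop]
    · obtain ⟨hl0, hmem⟩ := Finset.mem_filter.1 hl
      obtain ⟨γ, rfl⟩ := mem_VL.1 hl0
      have hi := List.idxOf_lt_length_iff.2 hmem
      exact class1_mem γ hpm hpq hv' hd hd' he2 hi (List.getElem_idxOf hi)
  -- class 2: replace the last vertex `v` by `v'`
  have b2 : ∑ l ∈ ((VL Λ e (door m p)).filter (fun l => bv m p' ∉ l)).filter (fun l => bv m q ∈ l),
      hexCriticalFugacity ^ l.length ≤ Z Λ e (door m p') := by
    rw [Z_eq_sum]
    refine (Finset.sum_congr rfl fun l hl => ?_).trans_le (HV.sum_le_sum_of_injOn_of_nonneg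
      (fun l : List HexVertex => l.dropLast ++ [bv m p']) (fun l₁ h₁ l₂ h₂ h => ?_) (fun l hl => ?_)
      (fun l : List HexVertex => hexCriticalFugacity ^ l.length) fun _ _ => pow_nonneg hx0.le _)
    · obtain ⟨hne, -⟩ := hlv l (Finset.mem_filter.1 (Finset.mem_filter.1 hl).1).1
      show _ = hexCriticalFugacity ^ (l.dropLast ++ [bv m p']).length
      rw [List.length_append, List.length_dropLast, List.length_singleton,
        Nat.sub_add_cancel (List.length_pos_iff.2 hne)]
    · have e₁ := (hlv l₁ (Finset.mem_filter.1 (Finset.mem_filter.1 (Finset.mem_coe.1 h₁)).1).1).2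
      have e₂ := (hlv l₂ (Finset.mem_filter.1 (Finset.mem_filter.1 (Finset.mem_coe.1 h₂)).1).1).2
      rw [← e₁, ← e₂, List.append_cancel_right h]
    · obtain ⟨hl, hul⟩ := Finset.mem_filter.1 hl
      obtain ⟨hl0, hv'l⟩ := Finset.mem_filter.1 hl
      obtain ⟨γ, rfl⟩ := mem_VL.1 hl0
      exact class2_mem γ hpm hpq hv' hd hd' he1 he2 he3 he4 hul hv'l
  -- class 3: append `u, v'`
  have b3 : ∑ l ∈ ((VL Λ e (door m p)).filter (fun l => bv m p' ∉ l)).filter (fun l => bv m q ∉ l),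
      hexCriticalFugacity ^ l.length ≤ hexCriticalFugacity⁻¹ ^ 2 * Z Λ e (door m p') := by
    rw [Z_eq_sum, Finset.mul_sum]
    refine (Finset.sum_congr rfl fun l _ => ?_).trans_le (HV.sum_le_sum_of_injOn_of_nonneg
      (fun l : List HexVertex => l ++ [bv m q] ++ [bv m p'])
      (fun l₁ _ l₂ _ h => List.append_cancel_right (List.append_cancel_right h)) (fun l hl => ?_)
      (fun l : List HexVertex => hexCriticalFugacity⁻¹ ^ 2 * hexCriticalFugacity ^ l.length)
      fun _ _ => mul_nonneg (pow_nonneg (inv_nonneg.2 hx0.le) _) (pow_nonneg hx0.le _))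
    · show _ = hexCriticalFugacity⁻¹ ^ 2 * hexCriticalFugacity ^ (l ++ [bv m q] ++ [bv m p']).length
      rw [List.length_append, List.length_append, List.length_singleton, List.length_singleton,
        hx1 l.length, hx1 (l.length + 1), ← mul_assoc, sq]
    · obtain ⟨hl, hul⟩ := Finset.mem_filter.1 hl
      obtain ⟨hl0, hv'l⟩ := Finset.mem_filter.1 hl
      obtain ⟨γ, rfl⟩ := mem_VL.1 hl0
      exact class3_mem γ hpq hu hv' hd hd' he1 he2 he3 he4 hul hv'l
  -- assemble
  rw [Z_eq_sum Λ e (door m p), ← Finset.sum_filter_add_sum_filter_not _ (fun l => bv m p' ∈ l),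
    ← Finset.sum_filter_add_sum_filter_not ((VL Λ e (door m p)).filter fun l => bv m p' ∉ l)
      (fun l => bv m q ∈ l)]
  calc _ ≤ _ := add_le_add b1 (add_le_add b2 b3)
    _ = _ := by ring

end DoorShift

end Summit.CriticalPhenomena.SAWScalingLimit.Theorems.MassRatio.FlatRoot
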